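import Mathlib
import HarnessLib
import Literature.MathematicalPhysics.StatisticalMechanics.LatticeSobolev

/-!
# Pointwise control of lattice derivatives by local quadratic forms
# (Adams–Buchholz–Kotecký–Müller, Lemma 7.8 (7.86): Sobolev applied to `∇^α φ`)

[ABKM19] Lemma 7.8 bounds the field norm `|φ|_{k+1,X}` (a maximum of weighted `|∇^αφ(x)|`) by the
quadratic form `(φ, M_{k+1}^X φ)` by applying the Sobolev inequality Lemma 7.9 to `f = ∇^αφ` on the
cubes `B̂` ((7.86)).  With the mixed form of Lemma 7.9 (`LatticeSobolev.sq_le_sum_mixedDiff_sq`) this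
file provides the generic core of that step:

* `mixedDiff_iterDiff` — `∇^{𝟙_β}(∇^α φ) = ∇^{α + 𝟙_β} φ` (additivity of iterated gradients);
* **`iterDiff_sq_le_sum`** — for `ℓ ≥ 1`, every multi-index `α`, field `φ` and point `x`:
  `(∇^αφ(x))² ≤ 2^d Σ_{β ⊆ [d]} ℓ^{2|β|} ℓ^{−d} Σ_{v ∈ [0,ℓ)^d} (∇^{α+𝟙_β} φ(x+v))²`.

Everything is proved; no named fact.  The weights `h_k, L^{(k+1)|α|}` and the polymer geometry of
Lemma 7.8 proper are instance-specific and not here.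

## References
* S. Adams, S. Buchholz, R. Kotecký, S. Müller, arXiv:1910.13564, Lemma 7.8 (7.86)–(7.88)
  [AdamsBuchholzKoteckyMuller2019].
-/

noncomputable section

namespace Literature.MathematicalPhysics.StatisticalMechanics.GradientRG

open Finset
open Literature.MathematicalPhysics.StatisticalMechanics.GradientFRD (iterDiff)

variable {d M : ℕ}

/-- The indicator multi-index of `insert i β` is that of `β` plus `e_i` (`i ∉ β`).
[cite: AdamsBuchholzKoteckyMuller2019, Lemma 7.9] -/
theorem indicator_insert {β : Finset (Fin d)} {i : Fin d} (hi : i ∉ β) (α : Fin d → ℕ) :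
    (α + fun k => if k ∈ insert i β then 1 else 0) =
      (α + fun k => if k ∈ β then 1 else 0) + Pi.single i 1 := by
  funext k
  by_cases hk : k = i
  · subst hk; simp [hi]
  · simp [hk]

/-- **`∇^{𝟙_β}(∇^α φ) = ∇^{α + 𝟙_β} φ`.** [cite: AdamsBuchholzKoteckyMuller2019, Lemma 7.8 (7.86)] -/
theorem mixedDiff_iterDiff (β : Finset (Fin d)) (α : Fin d → ℕ) (φ : (Fin d → ZMod M) → ℝ) :
    mixedDiff β (iterDiff α φ) = iterDiff (α + fun k => if k ∈ β then 1 else 0) φ := by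
  induction β using Finset.induction_on with
  | empty =>
    rw [mixedDiff_empty]
    congr 1
  | insert i β hi ih =>
    rw [mixedDiff_insert hi, ih, indicator_insert hi, iterDiff_add_single]

/-- **Sobolev control of a lattice derivative at a point** ([ABKM19] (7.86), mixed form): for
`ℓ ≥ 1`, `(∇^αφ(x))² ≤ 2^d Σ_{β⊆[d]} (ℓ^{2|β|}/ℓ^d) Σ_{v : Fin d → Fin ℓ} (∇^{α+𝟙_β}φ(x + v))²`, the
inner sum running over the cube `x + [0,ℓ)^d`. [cite: AdamsBuchholzKoteckyMuller2019, Lemma 7.8 (7.86)] -/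
theorem iterDiff_sq_le_sum {ℓ : ℕ} (hℓ : 1 ≤ ℓ) (α : Fin d → ℕ) (φ : (Fin d → ZMod M) → ℝ)
    (x : Fin d → ZMod M) :
    (iterDiff α φ x) ^ 2 ≤ 2 ^ d * ∑ β ∈ (Finset.univ : Finset (Fin d)).powerset,
      ((ℓ : ℝ) ^ (2 * β.card) / (ℓ : ℝ) ^ d) *
        ∑ v : Fin d → Fin ℓ, (iterDiff (α + fun k => if k ∈ β then 1 else 0) φ
          (x + fun k => (((v k : ℕ)) : ZMod M))) ^ 2 := by
  have h := sq_le_sum_mixedDiff_sq (M := M) hℓ (Finset.univ : Finset (Fin d)) (iterDiff α φ) x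
  rw [Finset.card_univ, Fintype.card_fin] at h
  refine h.trans (le_of_eq ?_)
  congr 1
  refine sum_congr rfl fun β _ => ?_
  congr 1
  refine Fintype.sum_congr _ _ fun v => ?_
  rw [mixedDiff_iterDiff]
  congr 2
  funext k
  simp [boxShift]

end Literature.MathematicalPhysics.StatisticalMechanics.GradientRG

end
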